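import Literature.NumberTheory.LocalFields.MoritaPadicGamma

/-!
# Sketch — crux idea `gross-koblitz-profile` (seat 2, g20) for
`TwistFamilyManinDescent.EisensteinAdditiveManinResidual` (stmt-BirchSwinnertonDyer-25138).

First checkable statement of the line: the **digit principle** for Gross–Koblitz units.
By Gross–Koblitz, the unit part of the `𝔽_{p²}` Gauss sum with Teichmüller exponent `α = a + b p`
is `Γ_p(⟨α/(p²-1)⟩) Γ_p(⟨pα/(p²-1)⟩)` and the unit part of the product of the two `𝔽_p` Gauss sums with
exponents `a`, `b` is `Γ_p(a/(p-1)) Γ_p(b/(p-1))`; as `p`-adic integers `α/(p²-1) ≡ -a ≡ p - a (mod p)` and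
`a/(p-1) ≡ -a (mod p)`, so mod-`p` continuity of Morita's `Γ_p` (tree: `padicGammaNat_modEq_of_modEq`)
makes the two units congruent mod `p`.  Stated over the tree's integer model `padicGammaNat`.
BSD is not proved by this; Manin `c = 1` is not proved by this.
-/

namespace Summit.BirchSwinnertonDyer.BirchSwinnertonDyer.Cruxes.EisensteinAdditiveManinResidual.GrossKoblitzProfile

open Literature.NumberTheory.LocalFields

/-- Digit principle (first lemma of the line): for a prime `p ≥ 5` and digits `a, b < p`, the natural-number
shadows of the Gross–Koblitz units of `g_{p²}(ω₂^{-(a+bp)})` and of `g_p(ω^{-a}) g_p(ω^{-b})` agree mod `p`. -/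
def DigitPrinciple : Prop :=
  ∀ p : ℕ, p.Prime → 5 ≤ p → ∀ a b : ℕ, a < p → b < p →
    (padicGammaNat p (p ^ 2 - (a + b * p)) * padicGammaNat p (p ^ 2 - (b + a * p)) : ℤ)
      ≡ padicGammaNat p (p - a) * padicGammaNat p (p - b) [ZMOD p]

/-- The depth-`k` version fails in general (this is where a hypothetical `p ∣ c` at window length `ℓ ≥ 2` could hide):
digit principle mod `p^k` would need `α/(p²-1) ≡ a/(p-1) (mod p^k)`, false for `k ≥ 2` unless `a = b`. Recorded as the
negation target of the line. -/
def DigitPrincipleDepthTwoFails : Prop :=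
  ∃ p : ℕ, p.Prime ∧ 5 ≤ p ∧ ∃ a b : ℕ, a < p ∧ b < p ∧
    ¬ ((padicGammaNat p (p ^ 4 - (a + b * p) * (p ^ 2 + 1)) * padicGammaNat p (p ^ 4 - (b + a * p) * (p ^ 2 + 1)) : ℤ)
      ≡ padicGammaNat p (p ^ 2 - a * (p + 1)) * padicGammaNat p (p ^ 2 - b * (p + 1)) [ZMOD (p ^ 2 : ℤ)])

theorem digitPrinciple_holds : DigitPrinciple := by
  intro p hp hp5 a b ha hb
  have hp2 : p ≠ 2 := by omega
  have key : ∀ a b : ℕ, a < p → b < p →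
      padicGammaNat p (p ^ 2 - (a + b * p)) ≡ padicGammaNat p (p - a) [ZMOD p] := by
    intro a b ha hb
    have hmod : p - a ≡ p ^ 2 - (a + b * p) [MOD p ^ 1] := by
      rw [pow_one]
      refine (Nat.modEq_iff_dvd).2 ?_
      have hle1 : a + b * p ≤ p ^ 2 := by nlinarith
      have hle2 : a ≤ p := by omega
      push_cast [Nat.cast_sub hle1, Nat.cast_sub hle2]
      exact ⟨(p : ℤ) - b - 1, by ring⟩
    have := padicGammaNat_modEq_of_modEq hp hp2 1 hmod
    simpa only [pow_one, Nat.cast_id] using this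
  have h1 := key a b ha hb
  have h2 := key b a hb ha
  exact h1.mul h2

end Summit.BirchSwinnertonDyer.BirchSwinnertonDyer.Cruxes.EisensteinAdditiveManinResidual.GrossKoblitzProfile
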